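import Summits.QuantumFields.YangMills.Theorems.FluctuationComparisonRegPrIntLS2BetaL2TowerContractionFalse
import HarnessLib

/-!
# S2β · HAZARD «L2-GAUGE», UNIFORM FORM — for EVERY choice of the data a station-style prefix fixes first (`L`, `C_B`, `α`, the positive threshold profile `θ`)
# and EVERY pair of constants `(C₂, C₂′)`, an explicit NAKED-pair counterexample to `Σ_b ‖X j b‖² ≤ C₂·L^{−j}·Σ_ℓ‖ζ ℓ‖² + C₂′·L^{2(K−J)−j}·REL` exists

Cell `ym3-torus` (rung R3 = continuum `SU(2)` Yang–Mills on T³ at fixed lattice data — NOT d = 4, NOT infinite volume, NOT a mass gap, NOT Clay).  Width seat «width 20»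
`ym3-torus-px20` (gen 25), FREE px helper on crux `stmt-QuantumFields-20520`; `--kind proof --supports stmt-QuantumFields-20520 --as helper`, count-neutral,
DEFINITION-FREE (0 `def`, 0 `instance`, 0 `notation`, 0 `sorry`, default heartbeats).  Companion of ✓p839802 `…L2TowerContractionFalse` (desk RULING №128: the barrier
record for the struck (L2-TOWER) display; architect RULING «L2-GAUGE»).

WHY A SECOND FILE.  ✓`not_l2Tower_contraction` negates the letter with the constants `(C₂, C₂′)` chosen BEFORE `C_B, α, θ` — formally weaker than negating the
station-style prefix `∀ L C_B …, ∃ constants, ∀ F …` in which the constants may depend on everything fixed first.  THIS FILE closes that loophole: the quantifiers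
`L, C_B, α, θ, C₂, C₂′` are ALL outside, and the counterexample (family `F` with `F.L = L`, heights `J = 0 < K`, flat background, residual single-site bump) is
produced for each choice — so NO dependence of the constants on the prefix data rescues an `L^{−j}`-decaying ℓ² letter for the naked chart tower.

WHAT IS PROVED (sorry-free).  ★★★`exists_naked_l2Tower_counterexample (L) (hL : Odd L ∧ 1 < L) (θ) (hθ : ∀ i, 0 < θ i) (C_B α) (hCB : 0 ≤ C_B) (hα : 0 ≤ α) (C₂ C₂′)` :
there are `F` (`F.L = L`), `J ≤ K`, a background `U₀ ∈ histGood F ℰp θ K J` with (BKG)-class plaquettes at `(C_B, α)`, a fluctuation `ζ` (`‖ζ‖ ≤ π`, `e^ζU₀ ∈ histGood`,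
SAME FIBRE, window `1∕4` at every level `t ≤ K − J`) and a level `j ≤ K − J` at which
`C₂·(L⁻¹)^j·Σ_ℓ‖ζ ℓ‖² + C₂′·L^{2(K−J)−j}·REL < Σ_{b : PBond (F.P K) j} ‖X j b‖²` (`X` = ✓`linBudget_of_chartTower`'s `hXdef` text VERBATIM; `REL` = the purse's second
currency); ★`not_l2Tower_contraction_dep` — the station-prefix corollary `∀ L hL θ>0 C_B α ≥ 0, ¬ ∃ C₂ C₂′, ∀ F …`.  Proof = ✓p839802 §3–§4 by name (`sum_sq_relTower_bump_of_le`,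
`iter_bump_of_lt`, `descendTo_bump_eq`, `iter_blockAvg_one`, `expPoint_logVec_rel_mul_eq`, `norm_logVec_rel_gaugeAct_bump`, `transfUp_bump_of_le`).
SCOPE (as ✓p839802): NAKED pair only — no AxStage package; every packaged socket (hD, hDBX⁗, hRκ, hRρ) excludes the bump and is untouched.

HONEST SCOPE.  Quantifier bookkeeping over a landed counterexample; nothing of Bałaban's renormalisation-group analysis is asserted or proved ([Balaban1985Averaging] (11)–(13)
p.19 is the covariance the witness rides); (L2-VOL), (REG)@rep, (RES-u), the windows, GAP♯∘ (`stub_uniformFibreGapOrbit`, registry 3732b7df UNTOUCHED, 0∕5), the five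
registered stubs, S2β, crux 20520, 19936, 19200 and `YM3TorusSU2` are NOT proved; no registered stub is closed; rung R3 — NOT d = 4, NOT infinite volume, NOT a mass gap,
NOT Clay; the Yang–Mills mass gap is NOT proved.
-/

set_option autoImplicit false
noncomputable section
open scoped Matrix.Norms.L2Operator Real
open Finset
namespace Summit.QuantumFields.YangMills.Theorems.FluctuationComparisonRegPrIntLS2BetaL2TowerCounterexample

open Literature.MathematicalPhysics.QuantumLattice (su2Quat)
open Literature.MathematicalPhysics.QuantumFieldTheory.Balaban1983to89
open Literature.MathematicalPhysics.QuantumFieldTheory.Balaban1983to89.T4Continuum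
open Literature.MathematicalPhysics.QuantumFieldTheory.Balaban1983to89.T3ContinuumYM3Torus
open Literature.MathematicalPhysics.QuantumFieldTheory.Balaban1983to89.T3UnitScaleTilt (histGood)
open Literature.MathematicalPhysics.QuantumFieldTheory.Balaban1983to89.T3TiltDescent (descendTo)
open Literature.MathematicalPhysics.QuantumFieldTheory.Balaban1983to89.T3UnitLawDensityEML (ℰp)
open Literature.MathematicalPhysics.QuantumFieldTheory.Balaban1983to89.T4HaarSU2ExpChart (expPoint)
open Literature.MathematicalPhysics.QuantumFieldTheory.Balaban1983to89.T4ExpWindowSmallField (logVec norm_logVec_le_pi)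
open Literature.MathematicalPhysics.QuantumFieldTheory.Balaban1983to89.HaarExponentialChart
open Literature.MathematicalPhysics.QuantumFieldTheory.Balaban1983to89.B10Eq18SigmaSU2 (su2Coord)
open Literature.MathematicalPhysics.QuantumFieldTheory.Balaban1983to89.B10Eq18SigmaSU2Haar (rev norm_rev)
open Literature.MathematicalPhysics.QuantumFieldTheory.Balaban1983to89.B10Eq18SigmaSU2Window (norm_su2Coord)
open Literature.MathematicalPhysics.QuantumFieldTheory.Balaban1983to89.T3DescentFibreTower (plaqSmall_one)
open Summit.QuantumFields.YangMills.Theorems.FluctuationComparisonRegPrIntLS2BetaChartReadDescentOntoExpPoint (su2Coord_rev_mem_lie)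
open Summit.QuantumFields.YangMills.Theorems.FluctuationComparisonRegPrIntLS2BetaSmallBondGaugeToronObstruction (norm_logVec_su2Quat_one)
open Summit.QuantumFields.YangMills.Theorems.FluctuationComparisonRegPrIntLS2BetaGeodesicJensenLift (norm_logVec_su2Quat_expPoint)
open Summit.QuantumFields.YangMills.Theorems.FluctuationComparisonRegPrIntLS2BetaResidualGauge (gaugeAct_mem_histGood_iff)
open Summit.QuantumFields.YangMills.Theorems.FluctuationComparisonRegPrIntLS2BetaL2TowerContractionFalse

/-- ★★★ **THE NAKED-PAIR COUNTEREXAMPLE, FOR EVERY CHOICE OF PREFIX DATA AND CONSTANTS** — see the module header. Witness: `F := ⟨L, hL, m := 1⟩`, `J := 0`,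
`K := j + 1` with `C₂ < L^j`, flat `U₀ := 1`, the residual single-site bump `g := exp((1∕4)e₀)` at `emb^j(0)`, level `j`.
[cite: Balaban1985Averaging, (11)-(13) p.19; Balaban1987RG1, (0.4) p.253] -/
theorem exists_naked_l2Tower_counterexample (L : ℕ) (hL : Odd L ∧ 1 < L) (θ : ℕ → ℝ) (hθ : ∀ i, 0 < θ i)
    (C_B α : ℝ) (hCB : 0 ≤ C_B) (hα : 0 ≤ α) (C₂ C₂' : ℝ) :
    ∃ (F : T3Family) (_ : F.L = L) (J K : ℕ) (hJK : J ≤ K) (U₀ : GaugeField (F.P K) 0 (Matrix.specialUnitaryGroup (Fin 2) ℂ))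
      (ζ : PBond (F.P K) 0 → EuclideanSpace ℝ (Fin 3)),
      U₀ ∈ histGood F ℰp θ K J ∧
      (∀ t, t ≤ K - J → ∀ p : Plaq (F.P K) t,
          dist1 (GaugeField.plaqHol (Averaging.iter (fun k => BlockAveraging.blockAvg (P := F.P K) (j := k) ℰp) t U₀) p) ≤
            C_B * α * (F.L : ℝ) ^ (2 * t) * ((F.L : ℝ)⁻¹) ^ (2 * (K - J))) ∧
      (∀ ℓ, ‖ζ ℓ‖ ≤ Real.pi) ∧
      (fun ℓ => expPoint (ζ ℓ) * U₀ ℓ : GaugeField (F.P K) 0 (Matrix.specialUnitaryGroup (Fin 2) ℂ)) ∈ histGood F ℰp θ K J ∧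
      descendTo F ℰp J K hJK (fun ℓ => expPoint (ζ ℓ) * U₀ ℓ : GaugeField (F.P K) 0 (Matrix.specialUnitaryGroup (Fin 2) ℂ)) = descendTo F ℰp J K hJK U₀ ∧
      (∀ t, t ≤ K - J → ∀ b : PBond (F.P K) t,
        ‖logVec (su2Quat (Averaging.iter (fun k => BlockAveraging.blockAvg (P := F.P K) (j := k) ℰp) t (fun ℓ => expPoint (ζ ℓ) * U₀ ℓ : GaugeField (F.P K) 0 (Matrix.specialUnitaryGroup (Fin 2) ℂ)) b * (Averaging.iter (fun k => BlockAveraging.blockAvg (P := F.P K) (j := k) ℰp) t U₀ b)⁻¹))‖ ≤ 1 / 4) ∧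
      ∃ j, j ≤ K - J ∧
        C₂ * ((F.L : ℝ)⁻¹) ^ j * ∑ ℓ : PBond (F.P K) 0, ‖ζ ℓ‖ ^ 2 +
          C₂' * (F.L : ℝ) ^ (2 * (K - J) - j) * ∑ p : Plaq (F.P K) 0,
            (1 - reTr ((GaugeField.plaqHol U₀ p)⁻¹ * GaugeField.plaqHol (fun ℓ => expPoint (ζ ℓ) * U₀ ℓ : GaugeField (F.P K) 0 (Matrix.specialUnitaryGroup (Fin 2) ℂ)) p)) <
        ∑ b : PBond (F.P K) j,
          ‖(⟨su2Coord (rev (logVec (su2Quat (Averaging.iter (fun k => BlockAveraging.blockAvg (P := F.P K) (j := k) ℰp) j (fun ℓ => expPoint (ζ ℓ) * U₀ ℓ : GaugeField (F.P K) 0 (Matrix.specialUnitaryGroup (Fin 2) ℂ)) b * (Averaging.iter (fun k => BlockAveraging.blockAvg (P := F.P K) (j := k) ℰp) j U₀ b)⁻¹)))), su2Coord_rev_mem_lie _⟩ : (specialUnitaryLogChart (Fin 2)).lie)‖ ^ 2 := by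
  have hL1 : (1 : ℝ) < (L : ℝ) := by exact_mod_cast hL.2
  obtain ⟨j, hj⟩ : ∃ j : ℕ, C₂ < (L : ℝ) ^ j := pow_unbounded_of_one_lt C₂ hL1
  let F : T3Family := ⟨L, hL, 1, le_rfl⟩
  let g : Matrix.specialUnitaryGroup (Fin 2) ℂ := expPoint (EuclideanSpace.single 0 (1 / 4 : ℝ))
  have hg : ‖logVec (su2Quat g)‖ = 1 / 4 := by
    have hA : ‖EuclideanSpace.single (0 : Fin 3) (1 / 4 : ℝ)‖ = 1 / 4 := by simp
    rw [norm_logVec_su2Quat_expPoint (by rw [hA]; linarith [Real.pi_gt_three]), hA]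
  let h : GaugeTransf (F.P (j + 1)) 0 (Matrix.specialUnitaryGroup (Fin 2) ℂ) :=
    fun x => if x = (fun _ : Fin (F.P (j + 1)).d => (((F.L ^ j - 1) / 2 : ℕ) : ZMod ((F.P (j + 1)).sitesPerDir 0))) then g else 1
  let U₀ : GaugeField (F.P (j + 1)) 0 (Matrix.specialUnitaryGroup (Fin 2) ℂ) := 1
  let ζ : PBond (F.P (j + 1)) 0 → EuclideanSpace ℝ (Fin 3) := fun ℓ => logVec (su2Quat (GaugeField.gaugeAct h U₀ ℓ * (U₀ ℓ)⁻¹))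
  have hU : (fun ℓ => expPoint (ζ ℓ) * U₀ ℓ : GaugeField (F.P (j + 1)) 0 (Matrix.specialUnitaryGroup (Fin 2) ℂ)) = GaugeField.gaugeAct h U₀ :=
    expPoint_logVec_rel_mul_eq F h U₀
  have hiter1 : ∀ t, Averaging.iter (fun k => BlockAveraging.blockAvg (P := F.P (j + 1)) (j := k) ℰp) t U₀ = 1 := iter_blockAvg_one F (j + 1)
  have h1 : U₀ ∈ histGood F ℰp θ (j + 1) 0 := by
    intro t _
    rw [hiter1 t]
    exact plaqSmall_one (hθ _)
  refine ⟨F, rfl, 0, j + 1, Nat.zero_le _, U₀, ζ, h1, ?_, fun ℓ => norm_logVec_le_pi _, ?_, ?_, ?_, j, by omega, ?_⟩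
  · intro t _ p
    rw [hiter1 t, B15Chi124DetSets.plaqHol_one, GaugeGroup.dist1_one]
    have : (0 : ℝ) ≤ (F.L : ℝ) := Nat.cast_nonneg _
    positivity
  · rw [hU]; exact (gaugeAct_mem_histGood_iff F h θ 0 U₀).mpr h1
  · rw [hU]; exact descendTo_bump_eq F (Nat.zero_le _) (by omega) g U₀
  · intro t ht b
    rw [hU]
    rcases Nat.lt_or_ge j t with hjt | hjt
    · have ht' : t = j + 1 + 0 := by omega
      subst ht'
      rw [iter_bump_of_lt F (by show j + 1 ≤ 1 + (j + 1 + 0); omega) g U₀ 0 (by show j + 1 + 0 ≤ 1 + (j + 1 + 0); omega), mul_inv_cancel,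
        norm_logVec_su2Quat_one]
      norm_num
    · have hT : transfUp h t = fun x : Site (F.P (j + 1)) t =>
          if x = (fun _ : Fin (F.P (j + 1)).d => (((F.L ^ (j - t) - 1) / 2 : ℕ) : ZMod ((F.P (j + 1)).sitesPerDir t))) then g else 1 :=
        funext (transfUp_bump_of_le (P := F.P (j + 1)) (by show j ≤ 1 + (j + 1); omega) g t hjt)
      rw [iter_gaugeAct (fun k => BlockAveraging.blockAvg (P := F.P (j + 1)) (j := k) ℰp) _ t (by show t ≤ 1 + (j + 1); omega) U₀,
        hT, norm_logVec_rel_gaugeAct_bump]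
      split_ifs
      · rw [hg]
      · norm_num
  · -- the two sides at level `j`
    have hLHS : ∑ b : PBond (F.P (j + 1)) j,
        ‖(⟨su2Coord (rev (logVec (su2Quat (Averaging.iter (fun k => BlockAveraging.blockAvg (P := F.P (j + 1)) (j := k) ℰp) j (fun ℓ => expPoint (ζ ℓ) * U₀ ℓ : GaugeField (F.P (j + 1)) 0 (Matrix.specialUnitaryGroup (Fin 2) ℂ)) b * (Averaging.iter (fun k => BlockAveraging.blockAvg (P := F.P (j + 1)) (j := k) ℰp) j U₀ b)⁻¹)))), su2Coord_rev_mem_lie _⟩ : (specialUnitaryLogChart (Fin 2)).lie)‖ ^ 2 =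
        2 * 3 * (1 / 4) ^ 2 := by
      rw [hU, ← hg, ← sum_sq_relTower_bump_of_le F (by show j ≤ 1 + (j + 1); omega) g U₀ le_rfl]
      refine Finset.sum_congr rfl fun b _ => ?_
      show ‖su2Coord (rev (logVec (su2Quat _)))‖ ^ 2 = _
      rw [norm_su2Coord, norm_rev]
    have hζ : ∑ ℓ : PBond (F.P (j + 1)) 0, ‖ζ ℓ‖ ^ 2 = 2 * 3 * (1 / 4) ^ 2 := by
      rw [← hg]
      exact (sum_sq_norm_logVec_rel_gaugeAct_bump U₀ _ g).trans (by simp)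
    have hREL : ∑ p : Plaq (F.P (j + 1)) 0,
        (1 - reTr ((GaugeField.plaqHol U₀ p)⁻¹ * GaugeField.plaqHol (fun ℓ => expPoint (ζ ℓ) * U₀ ℓ : GaugeField (F.P (j + 1)) 0 (Matrix.specialUnitaryGroup (Fin 2) ℂ)) p)) = 0 := by
      refine Finset.sum_eq_zero fun p _ => ?_
      rw [hU, T4WilsonGaugeFlatDirection.plaqHol_gaugeAct]
      show 1 - reTr ((GaugeField.plaqHol (1 : GaugeField (F.P (j + 1)) 0 (Matrix.specialUnitaryGroup (Fin 2) ℂ)) p)⁻¹ * (h p.src * GaugeField.plaqHol (1 : GaugeField (F.P (j + 1)) 0 (Matrix.specialUnitaryGroup (Fin 2) ℂ)) p * (h p.src)⁻¹)) = 0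
      rw [B15Chi124DetSets.plaqHol_one, mul_one, mul_inv_cancel, inv_one, mul_one, GaugeGroup.reTr_one, sub_self]
    rw [hLHS, hζ, hREL, mul_zero, add_zero]
    show C₂ * ((L : ℝ)⁻¹) ^ j * (2 * 3 * (1 / 4) ^ 2) < 2 * 3 * (1 / 4) ^ 2
    have hLj : (0 : ℝ) < (L : ℝ) ^ j := pow_pos (by linarith) j
    have hinv : ((L : ℝ)⁻¹) ^ j * (L : ℝ) ^ j = 1 := by rw [inv_pow, inv_mul_cancel₀ hLj.ne']
    nlinarith [hinv, hLj, hj]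

/-- ★ **THE STATION-PREFIX COROLLARY**: with `L`, the positive profile `θ` and the (BKG) constants `C_B, α ≥ 0` fixed FIRST, there are still no constants `(C₂, C₂′)` for the
naked-pair ℓ² letter (✓`not_l2Tower_contraction` is the special case with the constants chosen before `C_B, α, θ`). [cite: Balaban1985Averaging, (11)-(13) p.19] -/
theorem not_l2Tower_contraction_dep (L : ℕ) (hL : Odd L ∧ 1 < L) (θ : ℕ → ℝ) (hθ : ∀ i, 0 < θ i)
    (C_B α : ℝ) (hCB : 0 ≤ C_B) (hα : 0 ≤ α) :
    ¬ ∃ C₂ C₂' : ℝ, ∀ (F : T3Family), F.L = L → ∀ (J K : ℕ) (hJK : J ≤ K),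
      ∀ U₀ : GaugeField (F.P K) 0 (Matrix.specialUnitaryGroup (Fin 2) ℂ), U₀ ∈ histGood F ℰp θ K J →
        (∀ t, t ≤ K - J → ∀ p : Plaq (F.P K) t,
          dist1 (GaugeField.plaqHol (Averaging.iter (fun k => BlockAveraging.blockAvg (P := F.P K) (j := k) ℰp) t U₀) p) ≤
            C_B * α * (F.L : ℝ) ^ (2 * t) * ((F.L : ℝ)⁻¹) ^ (2 * (K - J))) →
        ∀ ζ : PBond (F.P K) 0 → EuclideanSpace ℝ (Fin 3), (∀ ℓ, ‖ζ ℓ‖ ≤ Real.pi) →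
          (fun ℓ => expPoint (ζ ℓ) * U₀ ℓ : GaugeField (F.P K) 0 (Matrix.specialUnitaryGroup (Fin 2) ℂ)) ∈ histGood F ℰp θ K J →
          descendTo F ℰp J K hJK (fun ℓ => expPoint (ζ ℓ) * U₀ ℓ : GaugeField (F.P K) 0 (Matrix.specialUnitaryGroup (Fin 2) ℂ)) = descendTo F ℰp J K hJK U₀ →
          (∀ t, t ≤ K - J → ∀ b : PBond (F.P K) t,
            ‖logVec (su2Quat (Averaging.iter (fun k => BlockAveraging.blockAvg (P := F.P K) (j := k) ℰp) t (fun ℓ => expPoint (ζ ℓ) * U₀ ℓ : GaugeField (F.P K) 0 (Matrix.specialUnitaryGroup (Fin 2) ℂ)) b * (Averaging.iter (fun k => BlockAveraging.blockAvg (P := F.P K) (j := k) ℰp) t U₀ b)⁻¹))‖ ≤ 1 / 4) →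
          ∀ j, j ≤ K - J →
            ∑ b : PBond (F.P K) j,
              ‖(⟨su2Coord (rev (logVec (su2Quat (Averaging.iter (fun k => BlockAveraging.blockAvg (P := F.P K) (j := k) ℰp) j (fun ℓ => expPoint (ζ ℓ) * U₀ ℓ : GaugeField (F.P K) 0 (Matrix.specialUnitaryGroup (Fin 2) ℂ)) b * (Averaging.iter (fun k => BlockAveraging.blockAvg (P := F.P K) (j := k) ℰp) j U₀ b)⁻¹)))), su2Coord_rev_mem_lie _⟩ : (specialUnitaryLogChart (Fin 2)).lie)‖ ^ 2 ≤
              C₂ * ((F.L : ℝ)⁻¹) ^ j * ∑ ℓ : PBond (F.P K) 0, ‖ζ ℓ‖ ^ 2 +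
              C₂' * (F.L : ℝ) ^ (2 * (K - J) - j) * ∑ p : Plaq (F.P K) 0,
                (1 - reTr ((GaugeField.plaqHol U₀ p)⁻¹ * GaugeField.plaqHol (fun ℓ => expPoint (ζ ℓ) * U₀ ℓ : GaugeField (F.P K) 0 (Matrix.specialUnitaryGroup (Fin 2) ℂ)) p)) := by
  rintro ⟨C₂, C₂', H⟩
  obtain ⟨F, hFL, J, K, hJK, U₀, ζ, h1, hBKG, hπ, h2, h3, hwin, j, hjK, hlt⟩ :=
    exists_naked_l2Tower_counterexample L hL θ hθ C_B α hCB hα C₂ C₂'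
  exact absurd (H F hFL J K hJK U₀ h1 hBKG ζ hπ h2 h3 hwin j hjK) (not_le.mpr hlt)

end Summit.QuantumFields.YangMills.Theorems.FluctuationComparisonRegPrIntLS2BetaL2TowerCounterexample

end
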